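import Literature.Geometry.Riemannian.L2ToponogovCosDistUniform
import Literature.Geometry.Riemannian.ExpMapHopfRinow
import HarnessLib

/-!
# Colding's common good geodesics (Colding 1996a, Lemma 2.10): near any two points there is a
# minimal geodesic along which finitely many `cos d_{x_i}` satisfy the spherical interpolation law

[Colding1996Shape, Lemma 2.10], in the form recorded by Hu–Yin (arXiv:1503.00889, Lemma 5.5 "see
also [C, Lemma 2.10]"): given `ε > 0` and finitely many points `x_1, …, x_m`, if
`Vol(M) > Vol(Sⁿ) − δ(ε, m, n)` then for all `y_1, y_2 ∈ M` there are `ȳ_1 ∈ B_{y_1}(ε)`,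
`ȳ_2 ∈ B_{y_2}(ε)` and a minimal geodesic `σ` from `ȳ_1` to `ȳ_2`, of length `l̄`, such that for
every `i` and all `s ∈ [0, l̄]`,
`|f_i(σ(s)) − f_i(ȳ_1) cos s − (f_i(ȳ_2) − f_i(ȳ_1) cos l̄)/sin l̄ · sin s| < ε`, `f_i = cos d_{x_i}`
(we keep the `sin l̄`-multiplied form, which is the one that is uniform in `l̄`).

Contents (all proved; no definitions, no named facts — D-0026):

* §1 `iInf_sum_iSup_ofReal_abs_sin_mul_sub_le` — pointwise, for a finite family of smooth
  functions `u_i`: the infimum over the minimal geodesics `γ` from `x` to `y` of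
  `Σ_i sup_{s∈[0,1]} |sin d · u_i(γ(sd)) − sin((1−s)d) u_i(x) − sin(sd) u_i(y)|` is at most
  `2 ℱ_{Σ_i |Hess u_i + u_i g|}(x, y)` (a COMMON geodesic for all `i`).
* §2 `lintegral_prod_iInf_sum_iSup_abs_sin_mul_sub_le_of_contMDiffRiemannianMetric` — integrated
  over `M × M` by the segment inequality, in the binders of `Colding1996_volume_ghClose`:
  `≤ 2 (2cosh(π/2))^{n−1} π (2V) Σ_i √(V (A_i + (n−1)√(A_i B_i)))`, `A_i = ‖Δu_i + nu_i‖₂²`,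
  `B_i = ‖u_i‖₂²`.
* §3 `lintegral_prod_iInf_sum_iSup_abs_sin_mul_cos_edist_sub_le_of_volume`,
  `exists_volume_deficit_forall_lintegral_prod_sum_toponogov_cos_edist_le` — for the functions
  `cos d_{x_i}` of `m` base points under `Vol ≥ (1 − δ)|Sⁿ|`: `≤ m Ψ(δ, n) Vol(M)²`, and the
  `ε`–`δ` form.
* §4 **`exists_volume_deficit_forall_exists_near_common_good_geodesic`** — Lemma 2.10: for
  `n ≥ 2`, `m`, `β > 0` and `0 < r ≤ π` there is `δ > 0` such that under `Ric ≥ n − 1`,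
  `Vol ≥ (1 − δ)|Sⁿ|`, for all base points `x : Fin m → M` and all `y₁, y₂` there are
  `ȳ₁, ȳ₂` with `d(y_k, ȳ_k) ≤ r` and a minimal geodesic `γ_v`, `v ∈ T_{ȳ₁}M`, `exp v = ȳ₂`,
  with `|sin d̄ · cos d_{x_i}(γ_v(s)) − sin((1−s)d̄) cos d_{x_i}(ȳ₁) − sin(s d̄) cos d_{x_i}(ȳ₂)| ≤ β`
  for all `i` and `s ∈ [0, 1]` (`d̄ = d(ȳ₁, ȳ₂)`) — by relative volume comparison the bad set
  cannot contain `B̄_r(y₁) × B̄_r(y₂)`.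

## References

* T. H. Colding, *Shape of manifolds with positive Ricci curvature*, Invent. Math. 124 (1996)
  175–191, Lemma 2.10. [Colding1996Shape]
* Z. Hu, L. Yin, *Shape of Alexandrov spaces with positive Ricci curvature*, arXiv:1503.00889,
  Lemma 5.5. [HuYin2015]
* T. H. Colding, *Aspects of Ricci curvature* (1997), Thm. 1.1, Thm. 2.2. [Colding1997Aspects]
-/

noncomputable section

open Bundle Set Function Filter MeasureTheory Manifold
open scoped Manifold ContDiff Topology ENNReal BigOperators

namespace Literature.Geometry.Riemannian

open Lorentzian Lorentzian.PseudoRiemannianMetric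

/-! ### §1 A common geodesic for a finite family, pointwise -/

section AlongGeodesics

variable {E : Type*} [NormedAddCommGroup E] [NormedSpace ℝ E] [FiniteDimensional ℝ E]
  [CompleteSpace E] {M : Type*} [TopologicalSpace M] [ChartedSpace E M] [IsManifold 𝓘(ℝ, E) ∞ M]
  [T2Space M]
  (g : PseudoRiemannianMetric 𝓘(ℝ, E) ∞ E (TangentSpace 𝓘(ℝ, E) : M → Type _)) [g.HasLeviCivita]

/-- **The interpolation defects of finitely many smooth functions along a COMMON minimal
geodesic are dominated by Cheeger–Colding's functional of the sum of their spherical Hessians**: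
for a complete Levi-Civita connection, smooth `u_i` (`i` in a finite type) and `x, y ∈ M`,
`inf_γ Σ_i sup_{s∈[0,1]} |sin d · u_i(γ(s)) − (sin((1−s)d) u_i(x) + sin(sd) u_i(y))|`
`  ≤ 2 ℱ_{Σ_i |Hess u_i + u_i g|_g}(x, y)`,
the infimum over the minimal `γ_v : [0,1] → M` from `x` to `y` (`ofReal_abs_sin_mul_sub_le_mul_lintegral`
for each `i` along the same `v`). [cite: Colding1996Shape, §1, Lemma 2.10] -/
theorem iInf_sum_iSup_ofReal_abs_sin_mul_sub_le (hg : g.IsRiemannian)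
    (hc : IsGeodesicallyComplete g.leviCivita) {ι : Type*} [Fintype ι] {u : ι → M → ℝ}
    (hu : ∀ i, ContMDiff 𝓘(ℝ, E) 𝓘(ℝ, ℝ) ∞ (u i)) (x y : M) :
    (⨅ v : {v : TangentSpace 𝓘(ℝ, E) x //
        IsMinimizingUpTo g hg x v 1 ∧ expMap g.leviCivita x v = y},
      ∑ i, ⨆ s : Icc (0:ℝ) 1,
        ENNReal.ofReal |Real.sin (g.edist hg x y).toReal *
            u i (expMap g.leviCivita x ((s : ℝ) • v.1)) -
          (Real.sin ((1 - s) * (g.edist hg x y).toReal) * u i x +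
            Real.sin (s * (g.edist hg x y).toReal) * u i y)|) ≤
      2 * segmentIntegral g hg
        (fun z ↦ ∑ i, ENNReal.ofReal (Real.sqrt (g.normSq z
          (g.hessian (u i) z + u i z • g.toBilinForm z)))) 0 1 x y := by
  classical
  haveI : Fact ((1 : ℕ∞ω) ≤ ((⊤ : ℕ∞) : ℕ∞ω)) := ⟨by exact_mod_cast le_top⟩
  have hk1 : ((1 : ℕ∞) : ℕ∞ω) + 1 ≤ ((⊤ : ℕ∞) : ℕ∞ω) := by
    rw [show ((1 : ℕ∞) : ℕ∞ω) + 1 = 2 by norm_num]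
    exact WithTop.coe_le_coe.2 le_top
  haveI : CovariantDerivative.ContMDiffCovariantDerivative g.leviCivita 1 :=
    ⟨g.isLocallyContMDiff_leviCivita_holds 1 hk1 univ isOpen_univ⟩
  rw [segmentIntegral, ENNReal.mul_iInf_of_ne two_ne_zero ENNReal.ofNat_ne_top]
  refine le_iInf fun w ↦ ?_
  obtain ⟨v, hv, hvy⟩ := w
  refine (iInf_le _ ⟨v, hv, hvy⟩).trans ?_
  subst hvy
  have hℓ : (g.edist hg x (expMap g.leviCivita x v)).toReal = Real.sqrt (g.val x v v) := by
    have h := (isMinimizingUpTo_one_iff hg hc x v).1 hv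
    rw [← h, ENNReal.toReal_ofReal (Real.sqrt_nonneg _)]
  simp only [hℓ]
  -- the integral of the sum is the sum of the integrals
  have hmeas : ∀ i, Measurable fun t : ℝ ↦ ENNReal.ofReal (Real.sqrt (g.normSq
      (expMap g.leviCivita x (t • v)) (g.hessian (u i) (expMap g.leviCivita x (t • v)) +
        u i (expMap g.leviCivita x (t • v)) • g.toBilinForm (expMap g.leviCivita x (t • v))))) := by
    intro i
    have hpath : Continuous fun t : ℝ ↦ expMap g.leviCivita x (t • v) := by
      have h1 : (fun t : ℝ ↦ expMap g.leviCivita x (t • v)) =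
          fun t ↦ maximalGeodesic g.leviCivita x v t := funext fun t ↦ expMap_smul hc x v t
      rw [h1]
      exact (maximalGeodesic_of_isGeodesicallyComplete hc x v).2.1.continuous
    exact ((ENNReal.continuous_ofReal.comp
      (continuous_sqrt_normSq_hessian_add_smul g (hu i))).comp hpath).measurable
  rw [lintegral_finsetSum _ fun i _ ↦ hmeas i, Finset.mul_sum, Finset.mul_sum]
  refine Finset.sum_le_sum fun i _ ↦ iSup_le fun s ↦ ?_
  exact ofReal_abs_sin_mul_sub_le_mul_lintegral g hg hc (hu i) x v s.2.1 s.2.2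

end AlongGeodesics

/-! ### §2 Integration over pairs, in the binders of the fact -/

section FactVocabulary

open Literature.Geometry.Lorentzian (riemannianMeasure)

/-- **The family interpolation estimate integrated over all pairs** (segment inequality with
`D = π` by Myers, Cauchy–Schwarz and Colding's `L²` Hessian estimate for each `u_i`): on a closed
connected Riemannian `n`-manifold `(M, h)`, `n ≥ 2`, `Ric ≥ (n−1)h`, for smooth `u_i`
(`i` in a finite type), with `V = μ_h(M)`, `A_i = ∫(Δu_i + nu_i)²`, `B_i = ∫u_i²`,
`∫_{M×M} inf_γ Σ_i sup_s |sin d · u_i(γ(sd)) − (sin((1−s)d) u_i(x) + sin(sd) u_i(y))| d(μ_h⊗μ_h)`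
`  ≤ 2 (2cosh(π/2))^{n−1} π (2V) Σ_i √(V (A_i + (n−1)√(A_i B_i)))`.
[cite: Colding1996Shape, §1, Lemma 2.10] [cite: CheegerColding1996, §2, Thm. 2.11] -/
theorem lintegral_prod_iInf_sum_iSup_abs_sin_mul_sub_le_of_contMDiffRiemannianMetric (n : ℕ)
    (hn : 2 ≤ n)
    (M : Type) [TopologicalSpace M] [T2Space M] [SecondCountableTopology M]
    [ChartedSpace (EuclideanSpace ℝ (Fin n)) M] [IsManifold (𝓡 n) ∞ M] [CompactSpace M]
    [ConnectedSpace M] [MeasurableSpace M] [BorelSpace M]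
    (h : Bundle.ContMDiffRiemannianMetric (𝓡 n) ∞ (EuclideanSpace ℝ (Fin n))
      (TangentSpace (𝓡 n) : M → Type _))
    [(PseudoRiemannianMetric.ofRiemannian h).HasLeviCivita]
    (hRic : ∀ (x : M) (v : TangentSpace (𝓡 n) x),
      ((n : ℝ) - 1) * h.inner x v v ≤ (PseudoRiemannianMetric.ofRiemannian h).ricci x v v)
    {ι : Type*} [Fintype ι] {u : ι → M → ℝ} (hu : ∀ i, ContMDiff (𝓡 n) 𝓘(ℝ, ℝ) ∞ (u i)) :
    ∫⁻ z, (⨅ v : {v : TangentSpace (𝓡 n) z.1 //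
          IsMinimizingUpTo (PseudoRiemannianMetric.ofRiemannian h)
              (PseudoRiemannianMetric.isRiemannian_ofRiemannian h) z.1 v 1 ∧
            expMap (PseudoRiemannianMetric.ofRiemannian h).leviCivita z.1 v = z.2},
        ∑ i, ⨆ s : Icc (0:ℝ) 1,
          ENNReal.ofReal |Real.sin ((PseudoRiemannianMetric.ofRiemannian h).edist
                (PseudoRiemannianMetric.isRiemannian_ofRiemannian h) z.1 z.2).toReal *
              u i (expMap (PseudoRiemannianMetric.ofRiemannian h).leviCivita z.1 ((s : ℝ) • v.1)) -
            (Real.sin ((1 - s) * ((PseudoRiemannianMetric.ofRiemannian h).edist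
                (PseudoRiemannianMetric.isRiemannian_ofRiemannian h) z.1 z.2).toReal) * u i z.1 +
              Real.sin (s * ((PseudoRiemannianMetric.ofRiemannian h).edist
                (PseudoRiemannianMetric.isRiemannian_ofRiemannian h) z.1 z.2).toReal) * u i z.2)|)
        ∂((riemannianMeasure h).prod (riemannianMeasure h)) ≤
      2 * ENNReal.ofReal ((2 * Real.cosh (Real.pi / 2)) ^ (n - 1) * Real.pi *
        (2 * (riemannianMeasure h univ).toReal) *
        ∑ i, Real.sqrt ((riemannianMeasure h univ).toReal *
          (∫ x, ((PseudoRiemannianMetric.ofRiemannian h).dalembertian (u i) x + n * u i x) ^ 2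
              ∂riemannianMeasure h +
            ((n : ℝ) - 1) * Real.sqrt
              ((∫ x, ((PseudoRiemannianMetric.ofRiemannian h).dalembertian (u i) x + n * u i x) ^ 2
                  ∂riemannianMeasure h) *
                ∫ x, u i x ^ 2 ∂riemannianMeasure h)))) := by
  classical
  set g := PseudoRiemannianMetric.ofRiemannian h with hg_def
  have hg : g.IsRiemannian := PseudoRiemannianMetric.isRiemannian_ofRiemannian h
  haveI : LocallyCompactSpace M :=
    Manifold.locallyCompact_of_finiteDimensional 𝓘(ℝ, (EuclideanSpace ℝ (Fin n)))
  haveI : T3Space M := inferInstance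
  haveI : IsFiniteMeasure (riemannianMeasure h) :=
    ⟨by
      have := riemannianVolume_lt_top_of_isCompact_holds h le_rfl isCompact_univ
      exact this⟩
  have hk1 : ((1 : ℕ∞) : ℕ∞ω) + 1 ≤ ((⊤ : ℕ∞) : ℕ∞ω) := by
    rw [show ((1 : ℕ∞) : ℕ∞ω) + 1 = 2 by norm_num]
    exact WithTop.coe_le_coe.2 le_top
  haveI : CovariantDerivative.ContMDiffCovariantDerivative g.leviCivita 1 :=
    ⟨g.isLocallyContMDiff_leviCivita_holds 1 hk1 univ isOpen_univ⟩
  haveI : CovariantDerivative.ContMDiffCovariantDerivative g.leviCivita ∞ :=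
    ⟨g.isLocallyContMDiff_leviCivita_holds ⊤ (le_of_eq rfl) univ isOpen_univ⟩
  have hn0 : 0 < n := lt_of_lt_of_le (by norm_num) hn
  have hn1 : 1 ≤ n := le_trans (by norm_num) hn
  have hc : IsGeodesicallyComplete g.leviCivita := hopfRinow_compact_geodesicallyComplete le_rfl hg
  have hfinE : Module.finrank ℝ (EuclideanSpace ℝ (Fin n)) = n := finrank_euclideanSpace_fin
  -- the majorants
  set F : ι → M → ℝ := fun i z ↦
    Real.sqrt (g.normSq z (g.hessian (u i) z + u i z • g.toBilinForm z)) with hF_def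
  have hFc : ∀ i, Continuous (F i) := fun i ↦ continuous_sqrt_normSq_hessian_add_smul g (hu i)
  have hF0 : ∀ i z, 0 ≤ F i z := fun i z ↦ Real.sqrt_nonneg _
  set f : M → ℝ≥0∞ := fun z ↦ ∑ i, ENNReal.ofReal (F i z) with hf_def
  have hfc : Continuous f :=
    continuous_finsetSum _ fun i _ ↦ ENNReal.continuous_ofReal.comp (hFc i)
  have hf : LowerSemicontinuous f := hfc.lowerSemicontinuous
  -- `Ric ≥ (n-1) h ≥ -(n-1) h`
  have hRic' : ∀ (x : M) (w : TangentSpace 𝓘(ℝ, (EuclideanSpace ℝ (Fin n))) x),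
      -((n : ℝ) - 1) * g.val x w w ≤ g.leviCivita.ricci x w w := by
    intro x w
    refine le_trans ?_ (hRic x w)
    have hw : 0 ≤ g.val x w w := by
      by_cases h0 : w = 0
      · simp [h0]
      · exact (hg x w h0).le
    have hd1 : (0 : ℝ) ≤ (n : ℝ) - 1 := by
      have : (2 : ℝ) ≤ n := by exact_mod_cast hn
      linarith
    show -((n : ℝ) - 1) * g.val x w w ≤ ((n : ℝ) - 1) * h.inner x w w
    have : g.val x w w = h.inner x w w := rfl
    rw [← this]
    nlinarith
  -- Myers: `d(x, y) ≤ π`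
  have hdiam : ∀ x ∈ (univ : Set M), ∀ y ∈ (univ : Set M),
      g.edist hg x y ≤ ENNReal.ofReal Real.pi := by
    intro x _ y _
    have h' := edist_le_pi_div_sqrt_of_ricci_ge_of_compactSpace g hg (by rw [hfinE]; exact hn)
      one_pos (fun x w ↦ by rw [hfinE, mul_one]; exact hRic x w) x y
    rwa [Real.sqrt_one, div_one] at h'
  have hU : ∀ x ∈ (univ : Set M), ∀ y ∈ (univ : Set M),
      ∀ v : TangentSpace 𝓘(ℝ, (EuclideanSpace ℝ (Fin n))) x,
        IsMinimizingUpTo g hg x v 1 → expMap g.leviCivita x v = y →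
          ∀ t ∈ Icc (0 : ℝ) 1, expMap g.leviCivita x (t • v) ∈ (univ : Set M) :=
    fun _ _ _ _ _ _ _ _ _ ↦ mem_univ _
  have hseg := setLIntegral_prod_segmentIntegral_le g hn0 hg hc hRic' MeasurableSet.univ
    MeasurableSet.univ MeasurableSet.univ Real.pi_pos.le hdiam hU hf
  rw [univ_prod_univ, Measure.restrict_univ, Measure.restrict_univ, ← two_mul] at hseg
  -- pointwise domination by `2 ℱ_f` and integration
  have hmeas : Measurable fun z : M × M ↦ segmentIntegral g hg f 0 1 z.1 z.2 :=
    measurable_segmentIntegral g hg hc hf 0 1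
  have hpt := fun z : M × M ↦ iInf_sum_iSup_ofReal_abs_sin_mul_sub_le g hg hc hu z.1 z.2
  have hstep1 : ∫⁻ z, (⨅ v : {v : TangentSpace (𝓡 n) z.1 //
          IsMinimizingUpTo g hg z.1 v 1 ∧ expMap g.leviCivita z.1 v = z.2},
        ∑ i, ⨆ s : Icc (0:ℝ) 1,
          ENNReal.ofReal |Real.sin (g.edist hg z.1 z.2).toReal *
              u i (expMap g.leviCivita z.1 ((s : ℝ) • v.1)) -
            (Real.sin ((1 - s) * (g.edist hg z.1 z.2).toReal) * u i z.1 +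
              Real.sin (s * (g.edist hg z.1 z.2).toReal) * u i z.2)|)
        ∂((riemannianMeasure h).prod (riemannianMeasure h)) ≤
      2 * ∫⁻ z, segmentIntegral g hg f 0 1 z.1 z.2
        ∂((riemannianMeasure h).prod (riemannianMeasure h)) := by
    rw [← lintegral_const_mul 2 hmeas]
    exact lintegral_mono fun z ↦ hpt z
  refine hstep1.trans ?_
  refine mul_le_mul_right (hseg.trans ?_) 2
  -- the real-valued bounds of `∫ F_i`
  set V : ℝ := (riemannianMeasure h univ).toReal with hV
  have hV0 : 0 ≤ V := ENNReal.toReal_nonneg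
  have hFi : ∀ i, Integrable (F i) (riemannianMeasure h) := fun i ↦
    integrable_of_continuous h (hFc i)
  have hint1 : ∀ i, ∫ z, F i z ∂riemannianMeasure h ≤
      Real.sqrt (V * ((∫ x, (g.dalembertian (u i) x + n * u i x) ^ 2 ∂riemannianMeasure h) +
        ((n : ℝ) - 1) * Real.sqrt ((∫ x, (g.dalembertian (u i) x + n * u i x) ^ 2
          ∂riemannianMeasure h) * ∫ x, u i x ^ 2 ∂riemannianMeasure h))) := by
    intro i
    have hF2 : ∀ z, F i z ^ 2 = g.normSq z (g.hessian (u i) z + u i z • g.toBilinForm z) :=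
      fun z ↦ Real.sq_sqrt (g.normSq_nonneg z hg _)
    have hF2i : Integrable (fun z ↦ F i z ^ 2) (riemannianMeasure h) :=
      integrable_of_continuous h ((hFc i).pow 2)
    have hHess := colding_integral_normSq_hessian_add_smul_le_sqrt h hn1 hRic (hu i)
    have hint2 : ∫ z, F i z ^ 2 ∂riemannianMeasure h ≤
        (∫ x, (g.dalembertian (u i) x + n * u i x) ^ 2 ∂riemannianMeasure h) +
          ((n : ℝ) - 1) * Real.sqrt ((∫ x, (g.dalembertian (u i) x + n * u i x) ^ 2
            ∂riemannianMeasure h) * ∫ x, u i x ^ 2 ∂riemannianMeasure h) := by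
      have h1 : ∫ z, F i z ^ 2 ∂riemannianMeasure h =
          ∫ z, g.normSq z (g.hessian (u i) z + u i z • g.toBilinForm z) ∂riemannianMeasure h :=
        integral_congr_ae (Eventually.of_forall hF2)
      rw [h1]
      exact hHess
    exact (integral_le_sqrt_measure_mul_integral_sq (hFi i) hF2i).trans
      (Real.sqrt_le_sqrt (mul_le_mul_of_nonneg_left hint2 hV0))
  have hlin : ∫⁻ y, f y ∂riemannianMeasure h =
      ∑ i, ENNReal.ofReal (∫ y, F i y ∂riemannianMeasure h) := by
    have hm : ∀ i ∈ (Finset.univ : Finset ι),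
        Measurable fun z ↦ ENNReal.ofReal (F i z) := fun i _ ↦
      (ENNReal.continuous_ofReal.comp (hFc i)).measurable
    have h1 := lintegral_finsetSum (μ := riemannianMeasure h) Finset.univ hm
    simp only [hf_def]
    rw [h1]
    refine Finset.sum_congr rfl fun i _ ↦ ?_
    exact (ofReal_integral_eq_lintegral_ofReal (hFi i) (Eventually.of_forall (hF0 i))).symm
  have hsum : ∑ i, ENNReal.ofReal (∫ y, F i y ∂riemannianMeasure h) ≤
      ENNReal.ofReal (∑ i, Real.sqrt (V *
        ((∫ x, (g.dalembertian (u i) x + n * u i x) ^ 2 ∂riemannianMeasure h) +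
          ((n : ℝ) - 1) * Real.sqrt ((∫ x, (g.dalembertian (u i) x + n * u i x) ^ 2
            ∂riemannianMeasure h) * ∫ x, u i x ^ 2 ∂riemannianMeasure h)))) := by
    rw [ENNReal.ofReal_sum_of_nonneg fun i _ ↦ Real.sqrt_nonneg _]
    exact Finset.sum_le_sum fun i _ ↦ ENNReal.ofReal_le_ofReal (hint1 i)
  have hVeq : riemannianMeasure h univ = ENNReal.ofReal V := by
    rw [hV, ENNReal.ofReal_toReal (measure_ne_top _ _)]
  have hC1 : 0 ≤ (2 * Real.cosh (Real.pi / 2)) ^ (n - 1) :=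
    pow_nonneg (mul_nonneg zero_le_two (Real.cosh_pos _).le) _
  have hC2 : 0 ≤ (2 * Real.cosh (Real.pi / 2)) ^ (n - 1) * Real.pi := mul_nonneg hC1 Real.pi_pos.le
  have hC0 : 0 ≤ (2 * Real.cosh (Real.pi / 2)) ^ (n - 1) * Real.pi * (2 * V) :=
    mul_nonneg hC2 (mul_nonneg zero_le_two hV0)
  have h2V : (2 : ℝ≥0∞) * ENNReal.ofReal V = ENNReal.ofReal (2 * V) := by
    rw [ENNReal.ofReal_mul zero_le_two, ENNReal.ofReal_ofNat]
  calc ENNReal.ofReal ((2 * Real.cosh (Real.pi / 2)) ^ (n - 1)) * ENNReal.ofReal Real.pi *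
        (2 * riemannianMeasure (I := 𝓘(ℝ, (EuclideanSpace ℝ (Fin n))))
          (g.toContMDiffRiemannianMetric hg) univ) *
        ∫⁻ y, f y ∂riemannianMeasure (I := 𝓘(ℝ, (EuclideanSpace ℝ (Fin n))))
          (g.toContMDiffRiemannianMetric hg)
      = ENNReal.ofReal ((2 * Real.cosh (Real.pi / 2)) ^ (n - 1) * Real.pi * (2 * V)) *
          ∑ i, ENNReal.ofReal (∫ y, F i y ∂riemannianMeasure h) := by
        change ENNReal.ofReal ((2 * Real.cosh (Real.pi / 2)) ^ (n - 1)) * ENNReal.ofReal Real.pi *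
            (2 * riemannianMeasure h univ) * ∫⁻ y, f y ∂riemannianMeasure h = _
        rw [hlin, hVeq, h2V, ← ENNReal.ofReal_mul hC1, ← ENNReal.ofReal_mul hC2]
    _ ≤ ENNReal.ofReal ((2 * Real.cosh (Real.pi / 2)) ^ (n - 1) * Real.pi * (2 * V)) *
          ENNReal.ofReal (∑ i, Real.sqrt (V *
            ((∫ x, (g.dalembertian (u i) x + n * u i x) ^ 2 ∂riemannianMeasure h) +
              ((n : ℝ) - 1) * Real.sqrt ((∫ x, (g.dalembertian (u i) x + n * u i x) ^ 2
                ∂riemannianMeasure h) * ∫ x, u i x ^ 2 ∂riemannianMeasure h)))) :=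
        mul_le_mul' le_rfl hsum
    _ = _ := by rw [← ENNReal.ofReal_mul hC0]

end FactVocabulary

/-! ### §3 The functions `cos d_{x_i}` of finitely many base points -/

section CosFamily

open Literature.Geometry.Lorentzian (riemannianMeasure)

/-- **The family interpolation estimate for `cos d_{x_i}`, explicit form**: under `Ric ≥ (n−1)h`,
`μ_h(M) ≥ (1 − δ)|Sⁿ|` (`0 < δ < 1/2`, `δ₁ = (2πⁿδ)^{1/n} < π/(2n)`), for base points `x_i`
(`i` in a finite type of cardinality `m`), with `η = δ₁ + (2nπ^{n−1}δ₁)^{1/n}`, `k = 4η + 2n²η²`,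
`Cₙ = (2cosh(π/2))^{n−1}π`:
`∫_{M×M} inf_γ Σ_i sup_s |sin d · cos d_{x_i}(γ(sd)) − (sin((1−s)d) cos d_{x_i}(x) + sin(sd) cos d_{x_i}(y))|`
`  ≤ m (4Cₙ√(k + (n−1)√k) + 3√(2n√η)) μ_h(M)²`
(each `cos d_{x_i}` is replaced by its smoothing `f_i` of `exists_smooth_approx_cos_riemannianEDist`
with `τ = √η`, at cost `3√(2nτ)` each, and the family estimate
`lintegral_prod_iInf_sum_iSup_abs_sin_mul_sub_le_of_contMDiffRiemannianMetric` is applied to the `f_i`).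
[cite: Colding1996Shape, §1 Prop. 1.15, §2 Lemma 2.10] [cite: Colding1997Aspects, Thm. 1.1, Thm. 2.2 (proof)] -/
theorem lintegral_prod_iInf_sum_iSup_abs_sin_mul_cos_edist_sub_le_of_volume (n : ℕ) (hn : 2 ≤ n)
    (M : Type) [TopologicalSpace M] [T2Space M] [SecondCountableTopology M]
    [ChartedSpace (EuclideanSpace ℝ (Fin n)) M] [IsManifold (𝓡 n) ∞ M] [CompactSpace M]
    [ConnectedSpace M] [MeasurableSpace M] [BorelSpace M]
    (h : Bundle.ContMDiffRiemannianMetric (𝓡 n) ∞ (EuclideanSpace ℝ (Fin n))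
      (TangentSpace (𝓡 n) : M → Type _))
    [(PseudoRiemannianMetric.ofRiemannian h).HasLeviCivita]
    (hRic : ∀ (x : M) (v : TangentSpace (𝓡 n) x),
      ((n : ℝ) - 1) * h.inner x v v ≤ (PseudoRiemannianMetric.ofRiemannian h).ricci x v v)
    {δ : ℝ} (hδ0 : 0 < δ) (hδ : δ < 1 / 2)
    (hδ₁ : (2 * Real.pi ^ n * δ) ^ ((n : ℝ)⁻¹) < Real.pi / (2 * n))
    (hvol : ENNReal.ofReal ((1 - δ) * unitSphereVolume n) ≤ riemannianMeasure h univ)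
    {η k : ℝ}
    (hη : η = (2 * Real.pi ^ n * δ) ^ ((n : ℝ)⁻¹) +
      (2 * n * Real.pi ^ (n - 1) * (2 * Real.pi ^ n * δ) ^ ((n : ℝ)⁻¹)) ^ ((n : ℝ)⁻¹))
    (hk : k = 4 * η + 2 * (n : ℝ) ^ 2 * η ^ 2) {ι : Type*} [Fintype ι] (x : ι → M) :
    ∫⁻ z, (⨅ v : {v : TangentSpace (𝓡 n) z.1 //
          IsMinimizingUpTo (PseudoRiemannianMetric.ofRiemannian h)
              (PseudoRiemannianMetric.isRiemannian_ofRiemannian h) z.1 v 1 ∧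
            expMap (PseudoRiemannianMetric.ofRiemannian h).leviCivita z.1 v = z.2},
        ∑ i, ⨆ s : Icc (0:ℝ) 1,
          ENNReal.ofReal |Real.sin ((PseudoRiemannianMetric.ofRiemannian h).edist
                (PseudoRiemannianMetric.isRiemannian_ofRiemannian h) z.1 z.2).toReal *
              Real.cos ((PseudoRiemannianMetric.ofRiemannian h).edist
                (PseudoRiemannianMetric.isRiemannian_ofRiemannian h) (x i)
                (expMap (PseudoRiemannianMetric.ofRiemannian h).leviCivita z.1 ((s : ℝ) • v.1))).toReal -
            (Real.sin ((1 - s) * ((PseudoRiemannianMetric.ofRiemannian h).edist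
                (PseudoRiemannianMetric.isRiemannian_ofRiemannian h) z.1 z.2).toReal) *
                Real.cos ((PseudoRiemannianMetric.ofRiemannian h).edist
                  (PseudoRiemannianMetric.isRiemannian_ofRiemannian h) (x i) z.1).toReal +
              Real.sin (s * ((PseudoRiemannianMetric.ofRiemannian h).edist
                (PseudoRiemannianMetric.isRiemannian_ofRiemannian h) z.1 z.2).toReal) *
                Real.cos ((PseudoRiemannianMetric.ofRiemannian h).edist
                  (PseudoRiemannianMetric.isRiemannian_ofRiemannian h) (x i) z.2).toReal)|)
        ∂((riemannianMeasure h).prod (riemannianMeasure h)) ≤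
      (Fintype.card ι : ℝ≥0∞) * (ENNReal.ofReal (4 * ((2 * Real.cosh (Real.pi / 2)) ^ (n - 1) * Real.pi) *
          Real.sqrt (k + ((n : ℝ) - 1) * Real.sqrt k) +
          3 * Real.sqrt (2 * n * Real.sqrt η)) * riemannianMeasure h univ ^ 2) := by
  classical
  set g := PseudoRiemannianMetric.ofRiemannian h with hg_def
  set hg : g.IsRiemannian := PseudoRiemannianMetric.isRiemannian_ofRiemannian h with hg'
  have hvolg : g.riemVolume = riemannianMeasure h := PseudoRiemannianMetric.riemVolume_eq hg
  have hUtop : riemannianMeasure h univ ≠ ⊤ := by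
    rw [← hvolg]; exact g.riemVolume_univ_lt_top.ne
  haveI : IsFiniteMeasure (riemannianMeasure h) := ⟨lt_top_iff_ne_top.2 hUtop⟩
  set U : ℝ≥0∞ := riemannianMeasure h univ with hU
  set V : ℝ := U.toReal with hV
  have hV0 : 0 ≤ V := ENNReal.toReal_nonneg
  have hUV : ENNReal.ofReal V = U := ENNReal.ofReal_toReal hUtop
  set δ₁ : ℝ := (2 * Real.pi ^ n * δ) ^ ((n : ℝ)⁻¹) with hδ₁_def
  have hδ₁pos : 0 < δ₁ := Real.rpow_pos_of_pos (by positivity) _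
  have hηpos : 0 < η := by
    rw [hη]
    exact add_pos_of_pos_of_nonneg hδ₁pos (Real.rpow_nonneg (by positivity) _)
  have hk0 : 0 ≤ k := by rw [hk]; positivity
  set τ : ℝ := Real.sqrt η with hτ_def
  have hτ : 0 < τ := Real.sqrt_pos.2 hηpos
  have hτ2 : τ ^ 2 = η := Real.sq_sqrt hηpos.le
  set ρ : ℝ := Real.sqrt (2 * n * τ) with hρ
  have hρ0 : 0 ≤ ρ := Real.sqrt_nonneg _
  set K : ℝ := (4 / τ ^ 2 + 2 * (n : ℝ) ^ 2) *
    (δ₁ + (2 * n * Real.pi ^ (n - 1) * δ₁) ^ ((n : ℝ)⁻¹)) ^ 2 * V with hK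
  have hkeq : (4 / τ ^ 2 + 2 * (n : ℝ) ^ 2) *
      (δ₁ + (2 * n * Real.pi ^ (n - 1) * δ₁) ^ ((n : ℝ)⁻¹)) ^ 2 = k := by
    rw [← hη, hk, hτ2]
    field_simp
  have hKk : K = k * V := by rw [hK, hkeq]
  have hn1 : (0 : ℝ) ≤ (n : ℝ) - 1 := by
    have : (2 : ℝ) ≤ n := by exact_mod_cast hn
    linarith
  -- the smoothed functions `f_i`
  have hex : ∀ i, ∃ f : M → ℝ, ContMDiff (𝓡 n) 𝓘(ℝ, ℝ) ∞ f ∧ (∀ y, |f y| ≤ 1) ∧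
      (∀ y, |f y - Real.cos (g.edist hg (x i) y).toReal| ≤ ρ) ∧
      ∫ y, (g.dalembertian f y + n * f y) ^ 2 ∂riemannianMeasure h ≤ K := by
    intro i
    obtain ⟨q, hpq⟩ := exists_riemannianEDist_ge_pi_sub_of_volume_ge n hn M h hRic hδ hvol (x i)
    obtain ⟨f, hf, h1, h2, -, h4, -⟩ :=
      exists_smooth_approx_cos_riemannianEDist n hn M h hRic hδ₁pos.le hδ₁ hpq hτ
    exact ⟨f, hf, h1, h2, h4⟩
  choose f hf h1 h2 h4 using hex
  -- `∫ f_i² ≤ V`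
  have hB : ∀ i, ∫ y, f i y ^ 2 ∂riemannianMeasure h ≤ V := by
    intro i
    have h1' : ∫ y, f i y ^ 2 ∂riemannianMeasure h ≤ ∫ _, (1 : ℝ) ∂riemannianMeasure h := by
      refine integral_mono_of_nonneg (Eventually.of_forall fun y ↦ sq_nonneg _)
        (integrable_const _) (Eventually.of_forall fun y ↦ ?_)
      have := sq_le_sq' (abs_le.1 (h1 i y)).1 (abs_le.1 (h1 i y)).2
      simpa using this
    rwa [integral_const, smul_eq_mul, mul_one, measureReal_def] at h1'
  -- the family estimate for the `f_i`, and its simplification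
  have h16 := lintegral_prod_iInf_sum_iSup_abs_sin_mul_sub_le_of_contMDiffRiemannianMetric n hn M
    h hRic hf
  set T : ℝ := Real.sqrt (k + ((n : ℝ) - 1) * Real.sqrt k) with hT
  have hT0 : 0 ≤ T := Real.sqrt_nonneg _
  have hmono : ∀ i, Real.sqrt (V * ((∫ y, (g.dalembertian (f i) y + n * f i y) ^ 2
      ∂riemannianMeasure h) + ((n : ℝ) - 1) * Real.sqrt ((∫ y, (g.dalembertian (f i) y +
        n * f i y) ^ 2 ∂riemannianMeasure h) * ∫ y, f i y ^ 2 ∂riemannianMeasure h))) ≤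
      V * T := by
    intro i
    set A : ℝ := ∫ y, (g.dalembertian (f i) y + n * f i y) ^ 2 ∂riemannianMeasure h with hA
    set B : ℝ := ∫ y, f i y ^ 2 ∂riemannianMeasure h with hB'
    have hA0 : 0 ≤ A := integral_nonneg fun y ↦ sq_nonneg _
    have hB0 : 0 ≤ B := integral_nonneg fun y ↦ sq_nonneg _
    have hAK : A ≤ k * V := hKk ▸ h4 i
    have hBV : B ≤ V := hB i
    have hsq : Real.sqrt (A * B) ≤ Real.sqrt (k * V * V) :=
      Real.sqrt_le_sqrt (mul_le_mul hAK hBV hB0 ((hA0.trans hAK)))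
    calc Real.sqrt (V * (A + ((n : ℝ) - 1) * Real.sqrt (A * B)))
        ≤ Real.sqrt (V * (k * V + ((n : ℝ) - 1) * Real.sqrt (k * V * V))) := by
          refine Real.sqrt_le_sqrt (mul_le_mul_of_nonneg_left ?_ hV0)
          nlinarith
      _ = V * T := by rw [hT]; exact sqrt_mul_add_mul_sqrt_eq hV0 hk0
  have hC0 : 0 ≤ (2 * Real.cosh (Real.pi / 2)) ^ (n - 1) * Real.pi := by positivity
  set m : ℕ := Fintype.card ι with hm
  have hsum : ∑ i, Real.sqrt (V * ((∫ y, (g.dalembertian (f i) y + n * f i y) ^ 2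
      ∂riemannianMeasure h) + ((n : ℝ) - 1) * Real.sqrt ((∫ y, (g.dalembertian (f i) y +
        n * f i y) ^ 2 ∂riemannianMeasure h) * ∫ y, f i y ^ 2 ∂riemannianMeasure h))) ≤
      m * (V * T) := by
    have h1 := Finset.sum_le_card_nsmul (Finset.univ : Finset ι) _ (V * T) fun i _ ↦ hmono i
    rwa [Finset.card_univ, nsmul_eq_mul] at h1
  have h16' := h16.trans (mul_le_mul_right (ENNReal.ofReal_le_ofReal
    (mul_le_mul_of_nonneg_left hsum (by positivity))) 2)
  -- pointwise replacement of `f_i` by `cos d_{x_i}`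
  have hpt : ∀ (i : ι) (y₁ y₂ w : M) (a b c : ℝ), |a| ≤ 1 → |b| ≤ 1 → |c| ≤ 1 →
      |a * Real.cos (g.edist hg (x i) w).toReal -
          (b * Real.cos (g.edist hg (x i) y₁).toReal + c * Real.cos (g.edist hg (x i) y₂).toReal)| ≤
        |a * f i w - (b * f i y₁ + c * f i y₂)| + 3 * ρ := by
    intro i y₁ y₂ w a b c ha hb hc
    have ew := h2 i w
    have ex := h2 i y₁
    have ey := h2 i y₂
    have key : |a * Real.cos (g.edist hg (x i) w).toReal -
          (b * Real.cos (g.edist hg (x i) y₁).toReal + c * Real.cos (g.edist hg (x i) y₂).toReal) -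
        (a * f i w - (b * f i y₁ + c * f i y₂))| ≤ 3 * ρ := by
      have e1 : a * Real.cos (g.edist hg (x i) w).toReal -
          (b * Real.cos (g.edist hg (x i) y₁).toReal + c * Real.cos (g.edist hg (x i) y₂).toReal) -
          (a * f i w - (b * f i y₁ + c * f i y₂)) =
          -(a * (f i w - Real.cos (g.edist hg (x i) w).toReal)) +
            b * (f i y₁ - Real.cos (g.edist hg (x i) y₁).toReal) +
            c * (f i y₂ - Real.cos (g.edist hg (x i) y₂).toReal) := by ring
      rw [e1]
      refine (abs_add_three _ _ _).trans ?_
      rw [abs_neg, abs_mul, abs_mul, abs_mul]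
      have i1 : |a| * |f i w - Real.cos (g.edist hg (x i) w).toReal| ≤ 1 * ρ :=
        mul_le_mul ha ew (abs_nonneg _) zero_le_one
      have i2 : |b| * |f i y₁ - Real.cos (g.edist hg (x i) y₁).toReal| ≤ 1 * ρ :=
        mul_le_mul hb ex (abs_nonneg _) zero_le_one
      have i3 : |c| * |f i y₂ - Real.cos (g.edist hg (x i) y₂).toReal| ≤ 1 * ρ :=
        mul_le_mul hc ey (abs_nonneg _) zero_le_one
      linarith
    have := abs_sub_abs_le_abs_sub
      (a * Real.cos (g.edist hg (x i) w).toReal -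
        (b * Real.cos (g.edist hg (x i) y₁).toReal + c * Real.cos (g.edist hg (x i) y₂).toReal))
      (a * f i w - (b * f i y₁ + c * f i y₂))
    linarith
  have hmeasU : ((riemannianMeasure h).prod (riemannianMeasure h)) univ = U ^ 2 := by
    rw [← univ_prod_univ, Measure.prod_prod, sq]
  -- integrate
  calc _ ≤ ∫⁻ z, ((⨅ v : {v : TangentSpace (𝓡 n) z.1 //
            IsMinimizingUpTo g hg z.1 v 1 ∧ expMap g.leviCivita z.1 v = z.2},
          ∑ i, ⨆ s : Icc (0:ℝ) 1,
            ENNReal.ofReal |Real.sin (g.edist hg z.1 z.2).toReal *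
                f i (expMap g.leviCivita z.1 ((s : ℝ) • v.1)) -
              (Real.sin ((1 - s) * (g.edist hg z.1 z.2).toReal) * f i z.1 +
                Real.sin (s * (g.edist hg z.1 z.2).toReal) * f i z.2)|) +
          (m : ℝ≥0∞) * ENNReal.ofReal (3 * ρ)) ∂((riemannianMeasure h).prod (riemannianMeasure h)) := by
        refine lintegral_mono fun z ↦ ?_
        rw [ENNReal.iInf_add]
        refine iInf_mono fun v ↦ ?_
        have hcard : (m : ℝ≥0∞) * ENNReal.ofReal (3 * ρ) = ∑ _i : ι, ENNReal.ofReal (3 * ρ) := by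
          rw [Finset.sum_const, Finset.card_univ, nsmul_eq_mul]
        rw [hcard, ← Finset.sum_add_distrib]
        refine Finset.sum_le_sum fun i _ ↦ ?_
        rw [ENNReal.iSup_add]
        refine iSup_mono fun s ↦ ?_
        rw [← ENNReal.ofReal_add (abs_nonneg _) (by positivity)]
        exact ENNReal.ofReal_le_ofReal (hpt i z.1 z.2 _ _ _ _ (Real.abs_sin_le_one _)
          (Real.abs_sin_le_one _) (Real.abs_sin_le_one _))
    _ = _ + (m : ℝ≥0∞) * ENNReal.ofReal (3 * ρ) * U ^ 2 := by
        rw [lintegral_add_right _ measurable_const, lintegral_const, hmeasU]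
    _ ≤ 2 * ENNReal.ofReal ((2 * Real.cosh (Real.pi / 2)) ^ (n - 1) * Real.pi * (2 * V) *
          (m * (V * T))) + (m : ℝ≥0∞) * ENNReal.ofReal (3 * ρ) * U ^ 2 := add_le_add h16' le_rfl
    _ = (m : ℝ≥0∞) * (ENNReal.ofReal (4 * ((2 * Real.cosh (Real.pi / 2)) ^ (n - 1) * Real.pi) * T +
          3 * ρ) * U ^ 2) := by
        have e1 : (2 : ℝ≥0∞) * ENNReal.ofReal ((2 * Real.cosh (Real.pi / 2)) ^ (n - 1) * Real.pi *
            (2 * V) * (m * (V * T))) =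
            (m : ℝ≥0∞) * (ENNReal.ofReal (4 * ((2 * Real.cosh (Real.pi / 2)) ^ (n - 1) * Real.pi) * T) *
              U ^ 2) := by
          rw [← hUV, sq, ← ENNReal.ofReal_mul hV0, ← ENNReal.ofReal_mul (by positivity),
            ← ENNReal.ofReal_natCast, ← ENNReal.ofReal_mul (by positivity),
            ← ENNReal.ofReal_ofNat 2, ← ENNReal.ofReal_mul (by norm_num)]
          congr 1
          ring
        have e2 : (m : ℝ≥0∞) * ENNReal.ofReal (3 * ρ) * U ^ 2 =
            (m : ℝ≥0∞) * (ENNReal.ofReal (3 * ρ) * U ^ 2) := by ring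
        rw [e1, e2, ← mul_add, ← add_mul, ← ENNReal.ofReal_add (by positivity) (by positivity)]

end CosFamily

/-! ### §4 The `ε`–`δ` form and Lemma 2.10 -/

section Lemma210

open Literature.Geometry.Lorentzian (riemannianMeasure)

/-- **The family interpolation estimate for `cos d_{x_i}`, `ε`–`δ` form**: for `n ≥ 2`, `m` and
`ε > 0` there is `δ > 0` such that under `Ric ≥ (n−1)h` and `μ_h(M) ≥ (1 − δ)|Sⁿ|`, for all base
points `x : Fin m → M`,
`∫_{M×M} inf_γ Σ_i sup_s |sin d · cos d_{x_i}(γ(sd)) − (sin((1−s)d) cos d_{x_i}(x) + sin(sd) cos d_{x_i}(y))|`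
`  ≤ ε μ_h(M)²`. [cite: Colding1996Shape, §2 Lemma 2.10] [cite: Colding1997Aspects, Thm. 1.1, Thm. 2.2 (proof)] -/
theorem exists_volume_deficit_forall_lintegral_prod_sum_toponogov_cos_edist_le (n : ℕ) (hn : 2 ≤ n)
    (m : ℕ) {ε : ℝ} (hε : 0 < ε) :
    ∃ δ : ℝ, 0 < δ ∧ ∀ (M : Type) [TopologicalSpace M] [T2Space M] [SecondCountableTopology M]
      [ChartedSpace (EuclideanSpace ℝ (Fin n)) M] [IsManifold (𝓡 n) ∞ M] [CompactSpace M]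
      [ConnectedSpace M] [MeasurableSpace M] [BorelSpace M]
      (h : Bundle.ContMDiffRiemannianMetric (𝓡 n) ∞ (EuclideanSpace ℝ (Fin n))
        (TangentSpace (𝓡 n) : M → Type _))
      [(PseudoRiemannianMetric.ofRiemannian h).HasLeviCivita],
      (∀ (x : M) (v : TangentSpace (𝓡 n) x),
          ((n : ℝ) - 1) * h.inner x v v ≤ (PseudoRiemannianMetric.ofRiemannian h).ricci x v v) →
        ENNReal.ofReal ((1 - δ) * unitSphereVolume n) ≤ riemannianMeasure h univ →
          ∀ x : Fin m → M,
            ∫⁻ z, (⨅ v : {v : TangentSpace (𝓡 n) z.1 //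
                  IsMinimizingUpTo (PseudoRiemannianMetric.ofRiemannian h)
                      (PseudoRiemannianMetric.isRiemannian_ofRiemannian h) z.1 v 1 ∧
                    expMap (PseudoRiemannianMetric.ofRiemannian h).leviCivita z.1 v = z.2},
                ∑ i, ⨆ s : Icc (0:ℝ) 1,
                  ENNReal.ofReal |Real.sin ((PseudoRiemannianMetric.ofRiemannian h).edist
                        (PseudoRiemannianMetric.isRiemannian_ofRiemannian h) z.1 z.2).toReal *
                      Real.cos ((PseudoRiemannianMetric.ofRiemannian h).edist
                        (PseudoRiemannianMetric.isRiemannian_ofRiemannian h) (x i)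
                        (expMap (PseudoRiemannianMetric.ofRiemannian h).leviCivita z.1
                          ((s : ℝ) • v.1))).toReal -
                    (Real.sin ((1 - s) * ((PseudoRiemannianMetric.ofRiemannian h).edist
                        (PseudoRiemannianMetric.isRiemannian_ofRiemannian h) z.1 z.2).toReal) *
                        Real.cos ((PseudoRiemannianMetric.ofRiemannian h).edist
                          (PseudoRiemannianMetric.isRiemannian_ofRiemannian h) (x i) z.1).toReal +
                      Real.sin (s * ((PseudoRiemannianMetric.ofRiemannian h).edist
                        (PseudoRiemannianMetric.isRiemannian_ofRiemannian h) z.1 z.2).toReal) *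
                        Real.cos ((PseudoRiemannianMetric.ofRiemannian h).edist
                          (PseudoRiemannianMetric.isRiemannian_ofRiemannian h) (x i) z.2).toReal)|)
                ∂((riemannianMeasure h).prod (riemannianMeasure h)) ≤
              ENNReal.ofReal ε * riemannianMeasure h univ ^ 2 := by
  have hn0 : (n : ℝ) ≠ 0 := by exact_mod_cast (show n ≠ 0 by omega)
  have hinv0 : (0 : ℝ) ≤ (n : ℝ)⁻¹ := by positivity
  have hinv_ne : ((n : ℝ)⁻¹) ≠ 0 := inv_ne_zero hn0
  -- the explicit error function and its continuity at `0`
  set C : ℝ := (2 * Real.cosh (Real.pi / 2)) ^ (n - 1) * Real.pi with hC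
  set d1 : ℝ → ℝ := fun δ ↦ (2 * Real.pi ^ n * δ) ^ ((n : ℝ)⁻¹) with hd1
  set eta : ℝ → ℝ := fun δ ↦ d1 δ + (2 * n * Real.pi ^ (n - 1) * d1 δ) ^ ((n : ℝ)⁻¹) with heta
  set kk : ℝ → ℝ := fun δ ↦ 4 * eta δ + 2 * (n : ℝ) ^ 2 * eta δ ^ 2 with hkk
  set Ψ : ℝ → ℝ := fun δ ↦ (m : ℝ) * (4 * C * Real.sqrt (kk δ + ((n : ℝ) - 1) * Real.sqrt (kk δ)) +
    3 * Real.sqrt (2 * n * Real.sqrt (eta δ))) with hΨ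
  have hc_d1 : Continuous d1 :=
    (Real.continuous_rpow_const hinv0).comp (continuous_const.mul continuous_id)
  have hc_eta : Continuous eta :=
    hc_d1.add ((Real.continuous_rpow_const hinv0).comp (continuous_const.mul hc_d1))
  have hc_kk : Continuous kk := (continuous_const.mul hc_eta).add (continuous_const.mul (hc_eta.pow 2))
  have hc_Ψ : Continuous Ψ :=
    continuous_const.mul (((continuous_const.mul (Real.continuous_sqrt.comp
      (hc_kk.add (continuous_const.mul (Real.continuous_sqrt.comp hc_kk))))).add
      (continuous_const.mul (Real.continuous_sqrt.comp
        (continuous_const.mul (Real.continuous_sqrt.comp hc_eta))))))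
  have hd1_0 : d1 0 = 0 := by simp only [hd1, mul_zero, Real.zero_rpow hinv_ne]
  have heta_0 : eta 0 = 0 := by
    simp only [heta, hd1_0, mul_zero, Real.zero_rpow hinv_ne, add_zero]
  have hkk_0 : kk 0 = 0 := by simp only [hkk, heta_0]; ring
  have hΨ0 : Ψ 0 = 0 := by
    simp only [hΨ, hkk_0, heta_0, Real.sqrt_zero, mul_zero, add_zero]
  have hev : ∀ᶠ δ in 𝓝 (0 : ℝ), Ψ δ < ε ∧ d1 δ < Real.pi / (2 * n) := by
    refine ((hc_Ψ.tendsto 0).eventually (gt_mem_nhds ?_)).and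
      ((hc_d1.tendsto 0).eventually (gt_mem_nhds ?_))
    · rwa [hΨ0]
    · rw [hd1_0]; positivity
  obtain ⟨δ₀, hδ₀, hball⟩ := Metric.eventually_nhds_iff.1 hev
  refine ⟨min (δ₀ / 2) (1 / 4), by positivity, ?_⟩
  intro M _ _ _ _ _ _ _ _ _ h _ hRic hvol x
  set δ : ℝ := min (δ₀ / 2) (1 / 4) with hδ_def
  have hδpos : 0 < δ := by positivity
  have hδlt : δ < 1 / 2 := (min_le_right _ _).trans_lt (by norm_num)
  have hδball : dist δ 0 < δ₀ := by
    rw [Real.dist_eq, sub_zero, abs_of_pos hδpos]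
    exact (min_le_left _ _).trans_lt (by linarith)
  obtain ⟨hΨε, hd1lt⟩ := hball hδball
  have hmain := lintegral_prod_iInf_sum_iSup_abs_sin_mul_cos_edist_sub_le_of_volume n hn M h hRic
    hδpos hδlt hd1lt hvol (η := eta δ) (k := kk δ) rfl rfl x
  refine hmain.trans ?_
  rw [Fintype.card_fin, ← mul_assoc, ← ENNReal.ofReal_natCast, ← ENNReal.ofReal_mul (Nat.cast_nonneg m)]
  exact mul_le_mul_left (ENNReal.ofReal_le_ofReal hΨε.le) _

/-- **Colding's Lemma 2.10 (common good geodesics near any pair of points).** For `n ≥ 2`, `m`,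
`β > 0` and `0 < r ≤ π` there is `δ > 0` such that: on every closed connected Riemannian
`n`-manifold `(M, h)` with `Ric ≥ (n − 1)h` and `μ_h(M) ≥ (1 − δ)|Sⁿ|`, for all base points
`x : Fin m → M` and all `y₁, y₂ ∈ M` there are `ȳ₁, ȳ₂` with `d(y₁, ȳ₁) ≤ r`, `d(y₂, ȳ₂) ≤ r` and a
minimal geodesic `γ_v(s) = exp_{ȳ₁}(s v)`, `s ∈ [0, 1]`, from `ȳ₁` to `ȳ₂` along which, for every
`i` and every `s ∈ [0, 1]` (`d̄ = d(ȳ₁, ȳ₂)`),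
`|sin d̄ · cos d_{x_i}(γ_v(s)) − (sin((1−s)d̄) cos d_{x_i}(ȳ₁) + sin(s d̄) cos d_{x_i}(ȳ₂))| ≤ β`
— the functions `cos d_{x_i}` restricted to `γ_v` are uniformly `β`-close to the solutions of
`φ'' + φ = 0` with the same boundary values (multiplied by `sin d̄`). Proof: by the `ε`–`δ`
family estimate and relative volume comparison
(`riemannianMeasure_univ_mul_le_closedBall_mul`) the set of bad pairs cannot contain
`B̄_r(y₁) × B̄_r(y₂)`. (Hu–Yin, Lemma 5.5: "see also [C, Lemma 2.10]".)
[cite: Colding1996Shape, §2, Lemma 2.10] [cite: HuYin2015, Lemma 5.5] -/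
theorem exists_volume_deficit_forall_exists_near_common_good_geodesic (n : ℕ) (hn : 2 ≤ n)
    (m : ℕ) {β : ℝ} (hβ : 0 < β) {r : ℝ} (hr : 0 < r) (hrπ : r ≤ Real.pi) :
    ∃ δ : ℝ, 0 < δ ∧ ∀ (M : Type) [TopologicalSpace M] [T2Space M] [SecondCountableTopology M]
      [ChartedSpace (EuclideanSpace ℝ (Fin n)) M] [IsManifold (𝓡 n) ∞ M] [CompactSpace M]
      [ConnectedSpace M] [MeasurableSpace M] [BorelSpace M]
      (h : Bundle.ContMDiffRiemannianMetric (𝓡 n) ∞ (EuclideanSpace ℝ (Fin n))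
        (TangentSpace (𝓡 n) : M → Type _))
      [(PseudoRiemannianMetric.ofRiemannian h).HasLeviCivita],
      (∀ (x : M) (v : TangentSpace (𝓡 n) x),
          ((n : ℝ) - 1) * h.inner x v v ≤ (PseudoRiemannianMetric.ofRiemannian h).ricci x v v) →
        ENNReal.ofReal ((1 - δ) * unitSphereVolume n) ≤ riemannianMeasure h univ →
          ∀ (x : Fin m → M) (y₁ y₂ : M), ∃ (z₁ z₂ : M) (v : TangentSpace (𝓡 n) z₁),
            ((PseudoRiemannianMetric.ofRiemannian h).edist
                (PseudoRiemannianMetric.isRiemannian_ofRiemannian h) y₁ z₁).toReal ≤ r ∧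
            ((PseudoRiemannianMetric.ofRiemannian h).edist
                (PseudoRiemannianMetric.isRiemannian_ofRiemannian h) y₂ z₂).toReal ≤ r ∧
            IsMinimizingUpTo (PseudoRiemannianMetric.ofRiemannian h)
                (PseudoRiemannianMetric.isRiemannian_ofRiemannian h) z₁ v 1 ∧
            expMap (PseudoRiemannianMetric.ofRiemannian h).leviCivita z₁ v = z₂ ∧
            ∀ i, ∀ s ∈ Icc (0:ℝ) 1,
              |Real.sin ((PseudoRiemannianMetric.ofRiemannian h).edist
                    (PseudoRiemannianMetric.isRiemannian_ofRiemannian h) z₁ z₂).toReal *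
                  Real.cos ((PseudoRiemannianMetric.ofRiemannian h).edist
                    (PseudoRiemannianMetric.isRiemannian_ofRiemannian h) (x i)
                    (expMap (PseudoRiemannianMetric.ofRiemannian h).leviCivita z₁ (s • v))).toReal -
                (Real.sin ((1 - s) * ((PseudoRiemannianMetric.ofRiemannian h).edist
                    (PseudoRiemannianMetric.isRiemannian_ofRiemannian h) z₁ z₂).toReal) *
                    Real.cos ((PseudoRiemannianMetric.ofRiemannian h).edist
                      (PseudoRiemannianMetric.isRiemannian_ofRiemannian h) (x i) z₁).toReal +
                  Real.sin (s * ((PseudoRiemannianMetric.ofRiemannian h).edist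
                    (PseudoRiemannianMetric.isRiemannian_ofRiemannian h) z₁ z₂).toReal) *
                    Real.cos ((PseudoRiemannianMetric.ofRiemannian h).edist
                      (PseudoRiemannianMetric.isRiemannian_ofRiemannian h) (x i) z₂).toReal)| ≤ β := by
  classical
  -- the relative volume of `r`-balls
  set κ : ℝ := unitSphereVolume (n - 1) * ∫ t in (0:ℝ)..r, Real.sin t ^ (n - 1) with hκ
  have hint_pos : 0 < ∫ t in (0:ℝ)..r, Real.sin t ^ (n - 1) := by
    refine intervalIntegral.intervalIntegral_pos_of_pos_on ?_ (fun t ht ↦ ?_) hr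
    · exact (Real.continuous_sin.pow _).intervalIntegrable _ _
    · exact pow_pos (Real.sin_pos_of_pos_of_lt_pi ht.1 (ht.2.trans_le hrπ)) _
  have hκ0 : 0 < κ := mul_pos (unitSphereVolume_pos _) hint_pos
  set σ : ℝ := unitSphereVolume n with hσ
  have hσ0 : 0 < σ := unitSphereVolume_pos n
  -- the deficit from the `ε`–`δ` family estimate with `ε = (β/4) (κ/σ)²`
  have hε : 0 < β / 4 * (κ / σ) ^ 2 := by positivity
  obtain ⟨δ, hδ, hmain⟩ :=
    exists_volume_deficit_forall_lintegral_prod_sum_toponogov_cos_edist_le n hn m hε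
  refine ⟨min δ (1 / 2), by positivity, ?_⟩
  intro M _ _ _ _ _ _ _ _ _ h _ hRic hvol x y₁ y₂
  set g := PseudoRiemannianMetric.ofRiemannian h with hg_def
  set hg : g.IsRiemannian := PseudoRiemannianMetric.isRiemannian_ofRiemannian h with hg'
  have hvolg : g.riemVolume = riemannianMeasure h := PseudoRiemannianMetric.riemVolume_eq hg
  have hUtop : riemannianMeasure h univ ≠ ⊤ := by
    rw [← hvolg]; exact g.riemVolume_univ_lt_top.ne
  haveI : IsFiniteMeasure (riemannianMeasure h) := ⟨lt_top_iff_ne_top.2 hUtop⟩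
  set μ : Measure M := riemannianMeasure h with hμ
  set U : ℝ≥0∞ := μ univ with hU
  -- volume hypotheses with `δ` and with `1/2`
  have hvolδ : ENNReal.ofReal ((1 - δ) * unitSphereVolume n) ≤ μ univ :=
    (ENNReal.ofReal_le_ofReal (mul_le_mul_of_nonneg_right (by linarith [min_le_left δ (1/2)])
      hσ0.le)).trans hvol
  have hUpos : 0 < U := by
    refine lt_of_lt_of_le ?_ hvol
    exact ENNReal.ofReal_pos.2 (mul_pos (by linarith [min_le_right δ (1/2)]) hσ0)
  have hI := hmain M h hRic hvolδ x
  -- the two balls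
  set B₁ : Set M := {z : M | (g.edist hg y₁ z).toReal ≤ r} with hB₁
  set B₂ : Set M := {z : M | (g.edist hg y₂ z).toReal ≤ r} with hB₂
  have hBc : ∀ y : M, IsClosed {z : M | (g.edist hg y z).toReal ≤ r} := fun y ↦
    isClosed_le (continuous_edist_toReal g hg y) continuous_const
  have hB₁m : MeasurableSet B₁ := (hBc y₁).measurableSet
  have hB₂m : MeasurableSet B₂ := (hBc y₂).measurableSet
  have hball : ∀ y : M, U * ENNReal.ofReal κ ≤ μ {z : M | (g.edist hg y z).toReal ≤ r} *
      ENNReal.ofReal σ := by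
    intro y
    have h1 := riemannianMeasure_univ_mul_le_closedBall_mul n hn M h hRic y hr hrπ
    refine h1.trans (mul_le_mul_left (measure_mono fun z hz ↦ ?_) _)
    exact ENNReal.toReal_le_of_le_ofReal hr.le hz
  -- if every pair in `B₁ × B₂` were bad
  by_contra hno
  push Not at hno
  set G : M × M → ℝ≥0∞ := fun z ↦ ⨅ v : {v : TangentSpace (𝓡 n) z.1 //
      IsMinimizingUpTo g hg z.1 v 1 ∧ expMap g.leviCivita z.1 v = z.2},
    ∑ i, ⨆ s : Icc (0:ℝ) 1,
      ENNReal.ofReal |Real.sin (g.edist hg z.1 z.2).toReal *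
          Real.cos (g.edist hg (x i) (expMap g.leviCivita z.1 ((s : ℝ) • v.1))).toReal -
        (Real.sin ((1 - s) * (g.edist hg z.1 z.2).toReal) * Real.cos (g.edist hg (x i) z.1).toReal +
          Real.sin (s * (g.edist hg z.1 z.2).toReal) * Real.cos (g.edist hg (x i) z.2).toReal)|
    with hG
  have hGbig : ∀ z ∈ B₁ ×ˢ B₂, ENNReal.ofReal β ≤ G z := by
    rintro ⟨z₁, z₂⟩ ⟨hz₁, hz₂⟩
    by_contra hlt
    push Not at hlt
    obtain ⟨⟨v, hv, hvz⟩, hvlt⟩ := iInf_lt_iff.1 hlt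
    obtain ⟨i, s, hs, hlt'⟩ := hno z₁ z₂ v hz₁ hz₂ hv hvz
    have h1 : ENNReal.ofReal |Real.sin (g.edist hg z₁ z₂).toReal *
          Real.cos (g.edist hg (x i) (expMap g.leviCivita z₁ (s • v))).toReal -
        (Real.sin ((1 - s) * (g.edist hg z₁ z₂).toReal) * Real.cos (g.edist hg (x i) z₁).toReal +
          Real.sin (s * (g.edist hg z₁ z₂).toReal) * Real.cos (g.edist hg (x i) z₂).toReal)| <
        ENNReal.ofReal β := by
      refine lt_of_le_of_lt ?_ hvlt
      refine le_trans ?_ (Finset.single_le_sum (f := fun i ↦ ⨆ s : Icc (0:ℝ) 1,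
        ENNReal.ofReal |Real.sin (g.edist hg z₁ z₂).toReal *
            Real.cos (g.edist hg (x i) (expMap g.leviCivita z₁ ((s : ℝ) • v))).toReal -
          (Real.sin ((1 - s) * (g.edist hg z₁ z₂).toReal) * Real.cos (g.edist hg (x i) z₁).toReal +
            Real.sin (s * (g.edist hg z₁ z₂).toReal) * Real.cos (g.edist hg (x i) z₂).toReal)|)
        (fun _ _ ↦ bot_le) (Finset.mem_univ i))
      exact le_iSup (fun s : Icc (0:ℝ) 1 ↦ ENNReal.ofReal |Real.sin (g.edist hg z₁ z₂).toReal *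
            Real.cos (g.edist hg (x i) (expMap g.leviCivita z₁ ((s : ℝ) • v))).toReal -
          (Real.sin ((1 - s) * (g.edist hg z₁ z₂).toReal) * Real.cos (g.edist hg (x i) z₁).toReal +
            Real.sin (s * (g.edist hg z₁ z₂).toReal) * Real.cos (g.edist hg (x i) z₂).toReal)|)
        ⟨s, hs⟩
    exact lt_irrefl _ (hlt'.trans ((ENNReal.ofReal_lt_ofReal_iff hβ).1 h1))
  -- integrate the indicator
  have hlow : ENNReal.ofReal β * (μ B₁ * μ B₂) ≤
      ENNReal.ofReal (β / 4 * (κ / σ) ^ 2) * U ^ 2 := by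
    have h1 : ∫⁻ z, (B₁ ×ˢ B₂).indicator (fun _ ↦ ENNReal.ofReal β) z ∂(μ.prod μ) ≤
        ∫⁻ z, G z ∂(μ.prod μ) := by
      refine lintegral_mono fun z ↦ ?_
      by_cases hz : z ∈ B₁ ×ˢ B₂
      · rw [indicator_of_mem hz]; exact hGbig z hz
      · rw [indicator_of_notMem hz]; exact bot_le
    rw [lintegral_indicator_const (hB₁m.prod hB₂m), Measure.prod_prod] at h1
    exact h1.trans hI
  -- contradiction with relative volume comparison
  have hb₁ := hball y₁
  have hb₂ := hball y₂
  have hB₁top : μ B₁ ≠ ⊤ := measure_ne_top _ _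
  have hB₂top : μ B₂ ≠ ⊤ := measure_ne_top _ _
  set V : ℝ := U.toReal with hV
  set b₁ : ℝ := (μ B₁).toReal with hb₁'
  set b₂ : ℝ := (μ B₂).toReal with hb₂'
  have hUV : U = ENNReal.ofReal V := (ENNReal.ofReal_toReal hUtop).symm
  have hb₁V : μ B₁ = ENNReal.ofReal b₁ := (ENNReal.ofReal_toReal hB₁top).symm
  have hb₂V : μ B₂ = ENNReal.ofReal b₂ := (ENNReal.ofReal_toReal hB₂top).symm
  have hV0 : 0 < V := by
    rw [hV]; exact ENNReal.toReal_pos hUpos.ne' hUtop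
  have hb₁0 : 0 ≤ b₁ := ENNReal.toReal_nonneg
  have hb₂0 : 0 ≤ b₂ := ENNReal.toReal_nonneg
  rw [hUV, hb₁V] at hb₁
  rw [hUV, hb₂V] at hb₂
  rw [hUV, hb₁V, hb₂V] at hlow
  rw [← ENNReal.ofReal_mul hV0.le, ← ENNReal.ofReal_mul hb₁0,
    ENNReal.ofReal_le_ofReal_iff (by positivity)] at hb₁
  rw [← ENNReal.ofReal_mul hV0.le, ← ENNReal.ofReal_mul hb₂0,
    ENNReal.ofReal_le_ofReal_iff (by positivity)] at hb₂
  rw [← ENNReal.ofReal_mul hb₁0, ← ENNReal.ofReal_mul hβ.le,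
    show ENNReal.ofReal V ^ 2 = ENNReal.ofReal (V * V) by rw [sq, ENNReal.ofReal_mul hV0.le],
    ← ENNReal.ofReal_mul hε.le, ENNReal.ofReal_le_ofReal_iff (by positivity)] at hlow
  -- `β (Vκ/σ)² ≤ β b₁ b₂ ≤ (β/4)(κ/σ)² V²`
  have h1 : V * κ / σ ≤ b₁ := by rw [div_le_iff₀ hσ0]; exact hb₁
  have h2 : V * κ / σ ≤ b₂ := by rw [div_le_iff₀ hσ0]; exact hb₂
  have h0 : 0 < V * κ / σ := by positivity
  have h3 : β * ((V * κ / σ) * (V * κ / σ)) ≤ β * (b₁ * b₂) :=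
    mul_le_mul_of_nonneg_left (mul_le_mul h1 h2 h0.le hb₁0) hβ.le
  have h4 : β * (b₁ * b₂) ≤ β / 4 * (κ / σ) ^ 2 * (V * V) := hlow
  have h5 : β * ((V * κ / σ) * (V * κ / σ)) = 4 * (β / 4 * (κ / σ) ^ 2 * (V * V)) := by
    field_simp
  have h6 : 0 < β / 4 * (κ / σ) ^ 2 * (V * V) := by positivity
  linarith

end Lemma210

end Literature.Geometry.Riemannian

end
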